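import Summits.ResolutionOfSingularities.ResolutionOfSingularities.Theorems.WeightedInvariantHypersurfaceLocalGameEFT4SDimLEDoor
import Summits.ResolutionOfSingularities.ResolutionOfSingularities.Theorems.WeightedInvariantIotaGenerizationClosed
import HarnessLib

/-!
# (c8) in the door setting: the restricted clause `IotaUpperSemicontinuousLE d p` transfers along lexicographic pairs,
# holds for `(ν ; ε)` UNCONDITIONALLY, and for generization-closed indicators follows from finiteness — door
# `HypersurfaceCentreConstruction` (stmt-ResolutionOfSingularities-19897), route `WeightedInvariant`, P3 rung `KeyRungLE 3 p`

[OURS · L1 W4.3 · cell `res-hironaka`, HUMAN RULING D-0089] Helper file `--supports stmt-ResolutionOfSingularities-19897`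
(res-type-047, on res-L1-w43-plan-1's RULING gen 11 #3 (12:37:46Z: the P3 rung is re-typed to the door setting — (c8)≤d,p
`IotaUpperSemicontinuousLE d p ι` quantifies over smooth quasi-compact `Y` over a PERFECT field of characteristic `p` all of whose
local rings have Krull dimension `≤ d`; res-type-098's `…EFT4SDimLEDoor`) and RULING gen 11 #4 (12:49:23Z: the tie bit `τ` is the
generization-closed indicator; (c8τ) from the FINITENESS of the tie points, res-type-047).  CANDIDATE DESIGN OBJECTS ONLY; nothing
here is a statement of the manuscript under review (Hironaka 2017, [claim: Hironaka2017, status: under-review]); nothing is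
attributed to its author; nothing here claims anything about resolution of singularities.  AI work, weaker than expert review.

## What is typed / proved

* `IotaUpperSemicontinuousOnLE d p ι₁ ι₂` — the stratum-relative clause (073's `IotaUpperSemicontinuousOn`, p504861) restricted exactly
  like `IotaUpperSemicontinuousLE d p`: on smooth quasi-compact `Y` over a perfect field of characteristic `p` with all stalks of
  dimension `≤ d`, `{ι₁ = α ∧ β ≤ ι₂}` is the trace of a closed set on the stratum `{ι₁ = α}`.  API: `…_of_on` (unrestricted ⇒
  restricted), `…_of_LE` (plain (c8)≤d,p for the second key ⇒ relative), `…_mono`.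
* **`iotaLex_upperSemicontinuousLE`** — (c8)≤d,p TRANSFERS along `iotaLex Λ ι₁ ι₂` (first key (c8)≤d,p, second key bounded by
  `Λ ≠ 0` and (c8)≤d,p along the strata of the first): res-type-073's `iotaLex_upperSemicontinuous` with the door-setting binders.
* **`iotaEps_upperSemicontinuousOnLE d p : IotaUpperSemicontinuousOnLE d p iotaOrd Iota3.iotaEps`** — from
  `Iota3.iotaEps_upperSemicontinuousOn_of_perfectField` (p530533; no J-2 residue over perfect fields) — and
  **`iotaOrdEps_upperSemicontinuousLE d p : IotaUpperSemicontinuousLE d p Iota3.iotaOrdEps` — the (c8)≤d,p CONJUNCT OF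
  `PRungLE d p` FOR THE PAIR `(ν ; ε)`, unconditional, every `d`, `p`.**
* `GenerizationClosed.indicator_upperSemicontinuousLE` / `…OnLE` — for a `{0,1}`-valued generization-closed indicator
  (`ι = 1 ↔ ∃ 𝔭, P (S_𝔭) (g/1)`, `P` iso-invariant): (c8)≤d,p follows from the finiteness of the `P`-points on every smooth
  quasi-compact `Y` of the door setting (dimension `≤ d`, perfect ground field of characteristic `p`) — so for the stratifier
  `(ν ; ε ; τ)` the clause (c8)≤3,p reduces to «the tie points of a smooth quasi-compact threefold are finitely many».

## References

* res-L1-w43-plan-1, RULINGS gen 11 #3/#4 (HOME/STATUS 2026-08-27T12:37:46Z / 12:49:23Z), `L/res-L1-w43-plan-1/IOTA3-DESIGN.md`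
  v1.3 §8.5 (OURS, AI planning); res-type-073 `…IotaLex` (p504861); res-type-013 `…Iota3Eps` (p527087).
-/

noncomputable section

set_option linter.dupNamespace false -- mandated namespace `Summit.<Summit>.<Problem>` of this single-conjunct summit

open CategoryTheory AlgebraicGeometry TopologicalSpace IsLocalRing Topology
open Literature.AlgebraicGeometry.Resolution

namespace Summit.ResolutionOfSingularities.ResolutionOfSingularities.Cruxes.HypersurfaceCentreConstruction.LocalEngine

/-! ## §1 The stratum-relative clause in the door setting -/

/-- [OURS · candidate · door setting] **(c8)≤d,p along the strata of a first key**: on a smooth quasi-compact scheme `Y` over a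
PERFECT field of characteristic `p` all of whose local rings have Krull dimension `≤ d`, for every global function `f` and ordinals
`α, β`, the set `{y | ι₁ = α ∧ β ≤ ι₂}` (values at the stalk germs of `f`) is the trace on the stratum `{y | ι₁ = α}` of a closed
subset of `Y` — res-type-073's `IotaUpperSemicontinuousOn` with the binders of `IotaUpperSemicontinuousLE d p`. -/
def IotaUpperSemicontinuousOnLE (d p : ℕ) (ι₁ ι₂ : (R : Type) → [CommRing R] → R → Ordinal.{0}) : Prop :=
  ∀ (k₀ : Type) [Field k₀] [CharP k₀ p] [PerfectField k₀]
    (Y : Scheme.{0}) (hY : Y ⟶ Spec (CommRingCat.of k₀)) [Smooth hY] [QuasiCompact hY],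
    (∀ y : ↥Y, ringKrullDim (Y.presheaf.stalk y) ≤ d) →
    ∀ (f : Γ(Y, ⊤)) (α β : Ordinal.{0}),
    ∃ C : Set ↥Y, IsClosed C ∧
      C ∩ {y : ↥Y | ι₁ (Y.presheaf.stalk y) (Y.presheaf.germ ⊤ y trivial f) = α} =
        {y : ↥Y | ι₁ (Y.presheaf.stalk y) (Y.presheaf.germ ⊤ y trivial f) = α ∧
          β ≤ ι₂ (Y.presheaf.stalk y) (Y.presheaf.germ ⊤ y trivial f)}

section OnLE

variable {d p : ℕ} {ι₁ ι₂ : (R : Type) → [CommRing R] → R → Ordinal.{0}}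

/-- The unrestricted stratum-relative clause implies the door-setting one. [OURS] -/
theorem iotaUpperSemicontinuousOnLE_of_on (h : IotaUpperSemicontinuousOn ι₁ ι₂) : IotaUpperSemicontinuousOnLE d p ι₁ ι₂ := by
  intro k₀ _ _ _ Y hY _ _ _ f α β
  exact h k₀ Y hY f α β

/-- The plain door-setting clause for the second key implies the stratum-relative one (`C := {β ≤ ι₂}`). [OURS] -/
theorem iotaUpperSemicontinuousOnLE_of_LE (h : IotaUpperSemicontinuousLE d p ι₂) : IotaUpperSemicontinuousOnLE d p ι₁ ι₂ := by
  intro k₀ _ _ _ Y hY _ _ hdim f α β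
  refine ⟨{y : ↥Y | β ≤ ι₂ (Y.presheaf.stalk y) (Y.presheaf.germ ⊤ y trivial f)}, h k₀ Y hY hdim f β, ?_⟩
  ext y
  simp only [Set.mem_inter_iff, Set.mem_setOf_eq]
  tauto

/-- Antitone in the dimension bound. [OURS] -/
theorem iotaUpperSemicontinuousOnLE_mono {d' : ℕ} (hdd' : d ≤ d') (h : IotaUpperSemicontinuousOnLE d' p ι₁ ι₂) :
    IotaUpperSemicontinuousOnLE d p ι₁ ι₂ := by
  intro k₀ _ _ _ Y hY _ _ hdim f α β
  exact h k₀ Y hY (fun y => (hdim y).trans (by exact_mod_cast hdd')) f α β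

end OnLE

/-! ## §2 (c8)≤d,p transfers along lexicographic pairs -/

section Lex

variable {d p : ℕ} {Λ : Ordinal.{0}} {ι₁ ι₂ : (R : Type) → [CommRing R] → R → Ordinal.{0}}

/-- **(c8)≤d,p transfers**: if the first key satisfies (c8)≤d,p, the second key is bounded by `Λ ≠ 0` and satisfies (c8)≤d,p
ALONG THE STRATA of the first key, then the lexicographic pair satisfies (c8)≤d,p.  (res-type-073's `iotaLex_upperSemicontinuous`,
p504861, with the door-setting binders: `{γ ≤ Λ·ι₁ + ι₂} = {a < ι₁} ∪ {ι₁ = a ∧ b ≤ ι₂}`, `γ = Λ·a + b`.) [OURS] -/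
theorem iotaLex_upperSemicontinuousLE (hΛ : Λ ≠ 0) (hb : IotaBoundedBy Λ ι₂) (h₁ : IotaUpperSemicontinuousLE d p ι₁)
    (h₂ : IotaUpperSemicontinuousOnLE d p ι₁ ι₂) : IotaUpperSemicontinuousLE d p (iotaLex Λ ι₁ ι₂) := by
  intro k₀ _ _ _ Y hY _ _ hdim f γ
  -- abbreviations for the two keys at the stalks
  set φ₁ : ↥Y → Ordinal.{0} := fun y => ι₁ (Y.presheaf.stalk y) (Y.presheaf.germ ⊤ y trivial f) with hφ₁
  set φ₂ : ↥Y → Ordinal.{0} := fun y => ι₂ (Y.presheaf.stalk y) (Y.presheaf.germ ⊤ y trivial f) with hφ₂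
  set a : Ordinal.{0} := γ / Λ with ha
  set b : Ordinal.{0} := γ % Λ with hb_def
  have hγ : γ = Λ * a + b := (Ordinal.div_add_mod γ Λ).symm
  have hbΛ : b < Λ := Ordinal.mod_lt γ hΛ
  obtain ⟨C, hC, hCE⟩ := h₂ k₀ Y hY hdim f a b
  have hA : IsClosed {y : ↥Y | a + 1 ≤ φ₁ y} := h₁ k₀ Y hY hdim f (a + 1)
  have hF : IsClosed {y : ↥Y | a ≤ φ₁ y} := h₁ k₀ Y hY hdim f a
  have key : {y : ↥Y | γ ≤ iotaLex Λ ι₁ ι₂ (Y.presheaf.stalk y) (Y.presheaf.germ ⊤ y trivial f)} =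
      {y : ↥Y | a + 1 ≤ φ₁ y} ∪ {y : ↥Y | φ₁ y = a ∧ b ≤ φ₂ y} := by
    ext y
    simp only [Set.mem_setOf_eq, Set.mem_union, iotaLex_apply]
    rw [hγ, lexPair_le_iff hbΛ (hb _ _), Order.add_one_le_iff]
    constructor
    · rintro (h | ⟨h1, h2⟩)
      · exact Or.inl h
      · exact Or.inr ⟨h1.symm, h2⟩
    · rintro (h | ⟨h1, h2⟩)
      · exact Or.inl h
      · exact Or.inr ⟨h1.symm, h2⟩
  rw [key]
  refine isClosed_union_of_trace (E := {y : ↥Y | φ₁ y = a}) (F := {y : ↥Y | a ≤ φ₁ y}) hA hF hC hCE ?_ ?_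
  · intro y hy
    exact le_of_eq (Eq.symm hy)
  · intro y hy
    have hy' : a ≤ φ₁ y := hy
    rcases hy'.lt_or_eq with h | h
    · exact Or.inl (Order.add_one_le_of_lt h)
    · exact Or.inr h.symm

/-- (c8)≤d,p transfers, plain second key. [OURS] -/
theorem iotaLex_upperSemicontinuousLE_of (hΛ : Λ ≠ 0) (hb : IotaBoundedBy Λ ι₂) (h₁ : IotaUpperSemicontinuousLE d p ι₁)
    (h₂ : IotaUpperSemicontinuousLE d p ι₂) : IotaUpperSemicontinuousLE d p (iotaLex Λ ι₁ ι₂) :=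
  iotaLex_upperSemicontinuousLE hΛ hb h₁ (iotaUpperSemicontinuousOnLE_of_LE h₂)

end Lex

/-! ## §3 The pair `(ν ; ε)`: (c8)≤d,p unconditionally -/

section Eps

/-- **(c8)≤d,p for `ε` along the `ν`-strata — UNCONDITIONAL** (the door setting has a perfect ground field, where regular = smooth
and the regular locus of a finite-type algebra is open: `Iota3.iotaEps_upperSemicontinuousOn_of_perfectField`, p530533).  The
dimension bound and the characteristic are not used. [OURS] -/
theorem iotaEps_upperSemicontinuousOnLE (d p : ℕ) : IotaUpperSemicontinuousOnLE d p iotaOrd Iota3.iotaEps := by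
  intro k₀ _ _ _ Y hY _ _ _ f α β
  exact Iota3.iotaEps_upperSemicontinuousOn_of_perfectField k₀ Y hY f α β

/-- **(c8)≤d,p for the pair `(ν ; ε) = Iota3.iotaOrdEps` — the (c8) conjunct of `PRungLE d p` for the two-letter stratifier,
unconditional for every `d`, `p`** ((c8) for `ν` on all smooth quasi-compact schemes over any field: res-type-039's
`iotaOrd_upperSemicontinuous`; ε along the ν-strata over perfect fields: p530533; transfer: §2). [OURS] -/
theorem iotaOrdEps_upperSemicontinuousLE (d p : ℕ) : IotaUpperSemicontinuousLE d p Iota3.iotaOrdEps :=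
  iotaLex_upperSemicontinuousLE Ordinal.omega0_ne_zero Iota3.iotaEps_boundedBy_omega0
    (iotaUpperSemicontinuousLE_of d p iotaOrd_upperSemicontinuous) (iotaEps_upperSemicontinuousOnLE d p)

end Eps

/-! ## §4 Generization-closed indicators: (c8)≤d,p from finiteness of the `P`-points in the door setting -/

namespace GenerizationClosed

variable (P : (R : Type) → [CommRing R] → R → Prop) (ι : (R : Type) → [CommRing R] → R → Ordinal.{0})
  (h01 : ∀ (S : Type) [CommRing S] (g : S), ι S g = 0 ∨ ι S g = 1)
  (h1 : ∀ (S : Type) [CommRing S] (g : S), ι S g = 1 ↔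
    ∃ 𝔭 : PrimeSpectrum S, P (Localization.AtPrime 𝔭.asIdeal) (algebraMap S (Localization.AtPrime 𝔭.asIdeal) g))
  (hP : ∀ (R T : Type) [CommRing R] [CommRing T] (e : R ≃+* T) (g : R), P R g ↔ P T (e g))
include h01 h1 hP

/-- **(c8)≤d,p for a generization-closed indicator from FINITENESS of the `P`-points in the door setting**: if on every
smooth quasi-compact `Y` over a perfect field of characteristic `p` with all stalks of dimension `≤ d` and every
`f ∈ Γ(Y, 𝒪_Y)` the set `{z | P (𝒪_{Y,z}, f_z)}` is finite, then the indicator `ι` (`ι = 1` iff some generization has `P`)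
satisfies `IotaUpperSemicontinuousLE d p ι` (`{1 ≤ ι}` = the finite union of the closures of the `P`-points,
`isClosed_setOf_exists_generization_of_finite`). [OURS] -/
theorem indicator_upperSemicontinuousLE {d p : ℕ}
    (hfin : ∀ (k₀ : Type) [Field k₀] [CharP k₀ p] [PerfectField k₀] (Y : Scheme.{0})
      (hY : Y ⟶ Spec (CommRingCat.of k₀)) [Smooth hY] [QuasiCompact hY],
      (∀ y : ↥Y, ringKrullDim (Y.presheaf.stalk y) ≤ d) →
      ∀ f : Γ(Y, ⊤), {z : Y | P (Y.presheaf.stalk z) ((Y.presheaf.germ ⊤ z trivial) f)}.Finite) :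
    IotaUpperSemicontinuousLE d p ι := by
  intro k₀ _ _ _ Y hY _ _ hdim f α
  rcases eq_or_ne α 0 with rfl | hα0
  · have : {y : Y | (0 : Ordinal) ≤ ι (Y.presheaf.stalk y) ((Y.presheaf.germ ⊤ y trivial) f)} = Set.univ := by
      ext y; simp
    rw [this]; exact isClosed_univ
  by_cases hα1 : α ≤ 1
  · have hset : {y : Y | α ≤ ι (Y.presheaf.stalk y) ((Y.presheaf.germ ⊤ y trivial) f)} =
        {y : Y | ∃ 𝔭 : PrimeSpectrum (Y.presheaf.stalk y),
          P (Localization.AtPrime 𝔭.asIdeal)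
            (algebraMap (Y.presheaf.stalk y) (Localization.AtPrime 𝔭.asIdeal) ((Y.presheaf.germ ⊤ y trivial) f))} := by
      ext y
      rw [Set.mem_setOf_eq, Set.mem_setOf_eq, ← h1]
      rcases h01 (Y.presheaf.stalk y) ((Y.presheaf.germ ⊤ y trivial) f) with h | h <;> rw [h]
      · simp only [nonpos_iff_eq_zero, zero_ne_one, iff_false]
        exact hα0
      · simp only [hα1]
    rw [hset]
    exact isClosed_setOf_exists_generization_of_finite P hP f (hfin k₀ Y hY hdim f)
  · have : {y : Y | α ≤ ι (Y.presheaf.stalk y) ((Y.presheaf.germ ⊤ y trivial) f)} = ∅ := by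
      ext y
      simp only [Set.mem_setOf_eq, Set.mem_empty_iff_false, iff_false]
      intro hα
      apply hα1
      rcases h01 (Y.presheaf.stalk y) ((Y.presheaf.germ ⊤ y trivial) f) with h | h
      · rw [h] at hα; exact hα.trans zero_le_one
      · rw [h] at hα; exact hα
    rw [this]; exact isClosed_empty

/-- The stratum-relative form in the door setting, along ANY first key `ι₁`. [OURS] -/
theorem indicator_upperSemicontinuousOnLE {d p : ℕ} (ι₁ : (R : Type) → [CommRing R] → R → Ordinal.{0})
    (hfin : ∀ (k₀ : Type) [Field k₀] [CharP k₀ p] [PerfectField k₀] (Y : Scheme.{0})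
      (hY : Y ⟶ Spec (CommRingCat.of k₀)) [Smooth hY] [QuasiCompact hY],
      (∀ y : ↥Y, ringKrullDim (Y.presheaf.stalk y) ≤ d) →
      ∀ f : Γ(Y, ⊤), {z : Y | P (Y.presheaf.stalk z) ((Y.presheaf.germ ⊤ z trivial) f)}.Finite) :
    IotaUpperSemicontinuousOnLE d p ι₁ ι :=
  iotaUpperSemicontinuousOnLE_of_LE (indicator_upperSemicontinuousLE P ι h01 h1 hP hfin)

end GenerizationClosed

end Summit.ResolutionOfSingularities.ResolutionOfSingularities.Cruxes.HypersurfaceCentreConstruction.LocalEngine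

end
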